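/- Copyright: ym-fleet seat `ym-infvol-p3` (prover, g4), for crux `HistoryTail` (stmt-QuantumFields-18916) of route
`UnitScaleTilt`, STUB 3 «chessboard ∕ reflection positivity» of the v5′ skeleton.  Released under the licence of the
surrounding project. -/
import Summits.QuantumFields.YangMills.Theorems.UnitScaleTiltHistoryTailChessboardTopField

/-!
# Chessboard for ONE top-level plaquette of the Gibbs tower, file 2: the MIRROR FAMILY of a top plaquette

Support file (helper lemmas, `--supports stmt-QuantumFields-18916`) for STUB 3 `stub_chessboardRP` of the v5′ birth
skeleton of crux `HistoryTail` (route `UnitScaleTilt`).  The chessboard estimate of Fröhlich–Israel–Lieb–Simon on the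
CUBE torus `BlockIdx P.d N` (top lattice of level `K` grouped into cubes of side `M`, `h : sitesPerDir K = M·N`,
`N` even) needs a family of cell observables COVARIANT under the cube-cut reflections (`hcov` of
`HistoryChessboardRP.chessboardFields_of_isReflectionPositiveBdd`).  For ONE top plaquette `p` the covariant family is
the family of its MIRROR COPIES over the cells («squares of the same colour on a chessboard»): since `P.L` is odd, the
cube side `M = L^s` is odd and a plaquette is never symmetric in its own cube, so translated copies will not do — the
copy in cube `c` is the image of `p` under the reflections leading from the cube of `p` to `c`, i.e. in every direction
`j` the offset of `p` in its cube is KEPT when `c_j` has the parity of the cube of `p` and MIRRORED (`r ↦ M − 1 − r`,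
one step lower in the two directions of the plaquette) otherwise.  This is bookkeeping on `ZMod (M·N)`; general
`P : Params` throughout.

WHAT.  §1 arithmetic of the cube-boundary index map `mulIdx M : ZMod N → ZMod (M·N)` (additive; `mulIdx_reflect`:
`M·(2k − 1 − t) = 2·(M·k) − M − M·t`) and of `cubeCut`; the PARITY map `parity hN : ZMod N →+* ZMod 2` for even `N`
(`parity_reflect`: the cell reflection `t ↦ 2k − 1 − t` FLIPS the parity).  §2 the mirror family: `extent`,
`baseOffset`, `offset`, `mirrorSrc`, **`mirror h hN p c`**; `val_mirrorSrc` (the labels in closed form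
`M·c_j + offset`), **`mirror_cubeOf`** (the copy in the cube of `p` is `p`), **`cubeOf_mirror_corners`** ∕
**`mirror_corners_mem`** (the four corners of the copy in cube `c` lie in cube `c`), **`mirror_injective`**, and the
covariance **`cutPlaq_mirror`**: `cutPlaq K i (cubeCut h k) (mirror c) = mirror (cellReflect i k c)` — the `sym` field
for file 3.  Standing hypothesis on `p` (`hp`): in every direction the offset of `p` in its cube plus its extent is
`< M` (the far corners of `p` lie in the cube of `p`).

HONEST SCOPE.  Finite-torus index arithmetic; nothing of Bałaban's estimates; the crux and its route stay CONDITIONAL on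
the (α) input package.  Not infinite volume, not a gap, not Clay.
-/

namespace Summit.QuantumFields.YangMills.Theorems.HistoryTailChessboardMirror

open Literature.Barriers.CriticalPhenomena.NonGibbs
open Literature.MathematicalPhysics.QuantumFieldTheory.Balaban1983to89
open Summit.QuantumFields.BalabanUV.T4Continuum
open HistoryRPTowerCuts HistoryRPTowerColumns HistoryChessboardEventsSplit
open HistoryChessboardEventsCubes HistoryChessboardEventsCubeSites
open Summit.QuantumFields.YangMills.Theorems.HistoryTailChessboardTopField

noncomputable section

/-! ## §1 Arithmetic: the cube-boundary index map is additive; parity on an even cyclic group -/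

section Arithmetic

variable {M N : ℕ}

/-- `mulIdx M` is additive (`M·((a + b) mod N) ≡ M·a + M·b (mod M·N)`). [folklore] -/
theorem mulIdx_add [NeZero N] (a b : ZMod N) : mulIdx M (a + b) = mulIdx M a + mulIdx M b := by
  simp only [mulIdx]
  rw [← Nat.cast_add, ZMod.natCast_eq_natCast_iff', ZMod.val_add, ← mul_add, Nat.mul_mod_mul_left,
    Nat.mul_mod_mul_left, Nat.mod_mod]

/-- `mulIdx M 0 = 0`. [folklore] -/
@[simp] theorem mulIdx_zero : mulIdx M (0 : ZMod N) = 0 := by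
  simp [mulIdx]

/-- `mulIdx M` commutes with negation. [folklore] -/
theorem mulIdx_neg [NeZero N] (a : ZMod N) : mulIdx M (-a) = -mulIdx M a := by
  refine eq_neg_of_add_eq_zero_left ?_
  rw [← mulIdx_add, neg_add_cancel, mulIdx_zero]

/-- `mulIdx M` commutes with subtraction. [folklore] -/
theorem mulIdx_sub [NeZero N] (a b : ZMod N) : mulIdx M (a - b) = mulIdx M a - mulIdx M b := by
  rw [sub_eq_add_neg, mulIdx_add, mulIdx_neg, ← sub_eq_add_neg]

/-- `mulIdx M 1 = M` (`N ≥ 2`). [folklore] -/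
theorem mulIdx_one (hN : 1 < N) : mulIdx M (1 : ZMod N) = (M : ZMod (M * N)) := by
  haveI : Fact (1 < N) := ⟨hN⟩
  simp [mulIdx, ZMod.val_one]

/-- **THE CELL REFLECTION UNDER `mulIdx`**: `M·(2k − 1 − t) = 2·(M·k) − M − M·t` in `ZMod (M·N)`. [folklore] -/
theorem mulIdx_reflect (hN : 1 < N) (k t : ZMod N) :
    mulIdx M (2 * k - 1 - t) = 2 * mulIdx M k - (M : ZMod (M * N)) - mulIdx M t := by
  haveI : NeZero N := ⟨by omega⟩
  rw [mulIdx_sub, mulIdx_sub, two_mul, mulIdx_add, mulIdx_one hN, two_mul]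

/-- an even nonzero natural number is at least `2`. [folklore] -/
theorem one_lt_of_even [NeZero N] (hN : Even N) : 1 < N := by
  have h0 := NeZero.ne N
  obtain ⟨m, hm⟩ := hN
  omega

/-- **THE PARITY MAP** of an even cyclic group: the reduction `ZMod N →+* ZMod 2` (`2 ∣ N`). -/
def parity (hN : Even N) : ZMod N →+* ZMod 2 := ZMod.castHom (even_iff_two_dvd.mp hN) (ZMod 2)

/-- **THE CELL REFLECTION FLIPS THE PARITY**: `parity (2k − 1 − t) = 1 + parity t`. [folklore] -/
theorem parity_reflect (hN : Even N) (k t : ZMod N) : parity hN (2 * k - 1 - t) = 1 + parity hN t := by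
  rw [map_sub, map_sub, map_mul, map_ofNat, map_one]
  have h2 : (2 : ZMod 2) = 0 := rfl
  rw [h2, zero_mul, zero_sub]
  generalize parity hN t = x
  revert x
  decide

/-- in `ZMod 2`, `1 + x = y ↔ x ≠ y`. [folklore] -/
theorem one_add_eq_iff_ne (x y : ZMod 2) : 1 + x = y ↔ x ≠ y := by
  revert x y
  decide

end Arithmetic

/-! ## §2 The mirror family of a top plaquette over the cube torus -/

section Mirror

variable {P : Params} {K M N : ℕ}

/-- `0 < M` when `sitesPerDir K = M·N`. [folklore] -/
theorem pos_of_sitesPerDir_eq (h : P.sitesPerDir K = M * N) : 0 < M :=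
  Nat.pos_of_ne_zero fun hM => P.sitesPerDir_ne_zero K (by rw [h, hM, zero_mul])

/-- `cubeCut` is W4-file-4c's `castZ` transport of `mulIdx`, i.e. Mathlib's ring isomorphism `ZMod.ringEquivCongr`
applied to it. [folklore] -/
theorem cubeCut_eq (h : P.sitesPerDir K = M * N) (k : ZMod N) :
    cubeCut h k = ZMod.ringEquivCongr h.symm (mulIdx M k) := by
  rw [cubeCut, castZ_eq_ringEquivCongr]

/-- **THE CELL REFLECTION UNDER `cubeCut`**: `cubeCut (2k − 1 − t) = 2·cubeCut k − M − cubeCut t`. [folklore] -/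
theorem cubeCut_reflect (h : P.sitesPerDir K = M * N) (hN : 1 < N) (k t : ZMod N) :
    cubeCut h (2 * k - 1 - t) = 2 * cubeCut h k - (M : ZMod (P.sitesPerDir K)) - cubeCut h t := by
  rw [cubeCut_eq, cubeCut_eq, cubeCut_eq, mulIdx_reflect hN, map_sub, map_sub, map_mul, map_ofNat, map_natCast]

/-- the cube index of a label with representative `M·a + s`, `s < M`, is `a`. [folklore] -/
theorem cubeIdx_of_val_eq {x : ZMod (P.sitesPerDir K)} {a s : ℕ} (hs : s < M) (hx : x.val = M * a + s) :
    cubeIdx M N x = (a : ZMod N) := by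
  unfold cubeIdx
  rw [hx, mul_add_div_of_lt a hs]

/-- the EXTENT of the plaquette `p` in direction `j`: `1` in its two directions, `0` otherwise. -/
def extent (p : Plaq P K) (j : Fin P.d) : ℕ := if p.μ = j ∨ p.ν = j then 1 else 0

variable (M) in
/-- the OFFSET of the base point of `p` inside its cube, direction `j`: `x_j mod M`. -/
def baseOffset (p : Plaq P K) (j : Fin P.d) : ℕ := (p.src j).val % M

/-- the base point of `p` in closed form: `x_j.val = M·(cube of p)_j.val + baseOffset`. [folklore] -/
theorem val_src_eq (h : P.sitesPerDir K = M * N) (p : Plaq P K) (j : Fin P.d) :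
    (p.src j).val = M * (cubeOf M N p.src j).val + baseOffset M p j := by
  have hlt : (p.src j).val / M < N := Nat.div_lt_of_lt_mul (by rw [← h]; exact ZMod.val_lt _)
  rw [cubeOf_apply, cubeIdx, ZMod.val_natCast_of_lt hlt, baseOffset]
  exact (Nat.div_add_mod _ _).symm

variable (M) in
/-- **THE OFFSET OF THE MIRROR COPY IN CUBE `c`**, direction `j`: the offset of `p` when `c_j` has the parity of the
cube of `p`, the mirrored offset `M − 1 − r − extent` otherwise. -/
def offset (hN : Even N) (p : Plaq P K) (c : BlockIdx P.d N) (j : Fin P.d) : ℕ :=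
  if parity hN (c j) = parity hN (cubeOf M N p.src j) then baseOffset M p j
  else M - 1 - baseOffset M p j - extent p j

variable (h : P.sitesPerDir K = M * N) (hN : Even N) (p : Plaq P K)

/-- **THE BASE POINT OF THE MIRROR COPY IN CUBE `c`**: `M·c_j + offset`. -/
def mirrorSrc (c : BlockIdx P.d N) : Site P K :=
  fun j => cubeCut h (c j) + ((offset M hN p c j : ℕ) : ZMod (P.sitesPerDir K))

/-- **THE MIRROR COPY OF `p` IN CUBE `c`** (same directions as `p`). -/
def mirror (c : BlockIdx P.d N) : Plaq P K := ⟨mirrorSrc h hN p c, p.μ, p.ν, p.hμν⟩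

/-- directions of the mirror copies. [folklore] -/
@[simp] theorem mirror_μ (c : BlockIdx P.d N) : (mirror h hN p c).μ = p.μ := rfl

/-- directions of the mirror copies. [folklore] -/
@[simp] theorem mirror_ν (c : BlockIdx P.d N) : (mirror h hN p c).ν = p.ν := rfl

/-- base point of the mirror copies. [folklore] -/
@[simp] theorem mirror_src (c : BlockIdx P.d N) : (mirror h hN p c).src = mirrorSrc h hN p c := rfl

/-- labels of the base point of the mirror copies. [folklore] -/
theorem mirrorSrc_apply (c : BlockIdx P.d N) (j : Fin P.d) :
    mirrorSrc h hN p c j = cubeCut h (c j) + ((offset M hN p c j : ℕ) : ZMod (P.sitesPerDir K)) := rfl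

variable {p} (hp : ∀ j : Fin P.d, baseOffset M p j + extent p j < M)
include hp

omit h in
/-- under the standing hypothesis, every offset plus the extent is `< M`. [folklore] -/
theorem offset_add_extent_lt (c : BlockIdx P.d N) (j : Fin P.d) : offset M hN p c j + extent p j < M := by
  unfold offset
  split_ifs
  · exact hp j
  · have := hp j; omega

omit h in
/-- … in particular every offset is `< M`. [folklore] -/
theorem offset_lt (c : BlockIdx P.d N) (j : Fin P.d) : offset M hN p c j < M := by
  have := offset_add_extent_lt hN hp c j; omega

variable [NeZero N]

/-- **THE LABELS OF THE MIRROR COPY IN CLOSED FORM**: `(mirrorSrc c j).val = M·c_j.val + offset`. [folklore] -/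
theorem val_mirrorSrc (c : BlockIdx P.d N) (j : Fin P.d) :
    (mirrorSrc h hN p c j).val = M * (c j).val + offset M hN p c j := by
  have hoff := offset_lt hN hp c j
  have hlt : M * (c j).val + offset M hN p c j < P.sitesPerDir K := by
    have h1 : (c j).val + 1 ≤ N := ZMod.val_lt (c j)
    calc M * (c j).val + offset M hN p c j < M * (c j).val + M := by omega
      _ = M * ((c j).val + 1) := by ring
      _ ≤ M * N := Nat.mul_le_mul_left M h1
      _ = P.sitesPerDir K := h.symm
  have e : mirrorSrc h hN p c j = ((M * (c j).val + offset M hN p c j : ℕ) : ZMod (P.sitesPerDir K)) := by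
    rw [mirrorSrc_apply, ← ZMod.natCast_zmod_val (cubeCut h (c j)), val_cubeCut]
    push_cast
    ring
  rw [e, ZMod.val_natCast_of_lt hlt]

/-- the label of the mirror copy stepped once in a direction OF `p` is still below the next cube boundary. [folklore] -/
theorem val_mirrorSrc_add_one (c : BlockIdx P.d N) (j : Fin P.d) (hj : p.μ = j ∨ p.ν = j) :
    (mirrorSrc h hN p c j + 1).val = M * (c j).val + (offset M hN p c j + 1) ∧ offset M hN p c j + 1 < M := by
  have hext : extent p j = 1 := by unfold extent; rw [if_pos hj]
  have hoff : offset M hN p c j + 1 < M := by have := offset_add_extent_lt hN hp c j; omega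
  refine ⟨?_, hoff⟩
  have hlt : M * (c j).val + (offset M hN p c j + 1) < P.sitesPerDir K := by
    have h1 : (c j).val + 1 ≤ N := ZMod.val_lt (c j)
    calc M * (c j).val + (offset M hN p c j + 1) < M * (c j).val + M := by omega
      _ = M * ((c j).val + 1) := by ring
      _ ≤ M * N := Nat.mul_le_mul_left M h1
      _ = P.sitesPerDir K := h.symm
  have e : mirrorSrc h hN p c j + 1 = ((M * (c j).val + (offset M hN p c j + 1) : ℕ) : ZMod (P.sitesPerDir K)) := by
    rw [← ZMod.natCast_zmod_val (mirrorSrc h hN p c j), val_mirrorSrc h hN hp]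
    push_cast
    ring
  rw [e, ZMod.val_natCast_of_lt hlt]

/-- **EVERY CORNER OF THE MIRROR COPY IN CUBE `c` LIES IN CUBE `c`.** [folklore] -/
theorem cubeOf_mirror_corners (c : BlockIdx P.d N) :
    cubeOf M N (mirrorSrc h hN p c) = c ∧ cubeOf M N ((mirrorSrc h hN p c).shift p.μ) = c ∧
      cubeOf M N ((mirrorSrc h hN p c).shift p.ν) = c ∧
      cubeOf M N (((mirrorSrc h hN p c).shift p.μ).shift p.ν) = c := by
  have base : ∀ j, cubeIdx M N (mirrorSrc h hN p c j) = c j := fun j => by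
    rw [cubeIdx_of_val_eq (offset_lt hN hp c j) (val_mirrorSrc h hN hp c j), ZMod.natCast_zmod_val]
  have stepped : ∀ j, (p.μ = j ∨ p.ν = j) → cubeIdx M N (mirrorSrc h hN p c j + 1) = c j := fun j hj => by
    obtain ⟨hv, hlt⟩ := val_mirrorSrc_add_one h hN hp c j hj
    rw [cubeIdx_of_val_eq hlt hv, ZMod.natCast_zmod_val]
  have hne : p.μ ≠ p.ν := p.hμν.ne
  -- the labels of the three stepped corners
  have eμ : ∀ j, (mirrorSrc h hN p c).shift p.μ j = if j = p.μ then mirrorSrc h hN p c p.μ + 1 else mirrorSrc h hN p c j :=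
    fun j => Site.shift_apply _ _ _
  have eν : ∀ j, (mirrorSrc h hN p c).shift p.ν j = if j = p.ν then mirrorSrc h hN p c p.ν + 1 else mirrorSrc h hN p c j :=
    fun j => Site.shift_apply _ _ _
  have eμν : ∀ j, ((mirrorSrc h hN p c).shift p.μ).shift p.ν j =
      if j = p.ν then mirrorSrc h hN p c p.ν + 1
      else if j = p.μ then mirrorSrc h hN p c p.μ + 1 else mirrorSrc h hN p c j := by
    intro j
    rw [Site.shift_apply, eμ, eμ, if_neg (Ne.symm hne)]
  refine ⟨funext fun j => ?_, funext fun j => ?_, funext fun j => ?_, funext fun j => ?_⟩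
  · rw [cubeOf_apply, base]
  · rw [cubeOf_apply, eμ]
    by_cases hj : j = p.μ
    · rw [if_pos hj, hj, stepped _ (Or.inl rfl)]
    · rw [if_neg hj, base]
  · rw [cubeOf_apply, eν]
    by_cases hj : j = p.ν
    · rw [if_pos hj, hj, stepped _ (Or.inr rfl)]
    · rw [if_neg hj, base]
  · rw [cubeOf_apply, eμν]
    by_cases hjν : j = p.ν
    · rw [if_pos hjν, hjν, stepped _ (Or.inr rfl)]
    · rw [if_neg hjν]
      by_cases hjμ : j = p.μ
      · rw [if_pos hjμ, hjμ, stepped _ (Or.inl rfl)]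
      · rw [if_neg hjμ, base]

/-- **THE FOUR CORNERS OF THE MIRROR COPY IN CUBE `c` ARE SITES OF CUBE `c`** (the `loc` hypothesis of file 1's
`measurable_dist1_plaqHol_last_cubePos`). [folklore] -/
theorem mirror_corners_mem (c : BlockIdx P.d N) :
    (mirror h hN p c).src ∈ cubeSites (K := K) M c ∧
      (mirror h hN p c).src.shift (mirror h hN p c).μ ∈ cubeSites (K := K) M c ∧
      (mirror h hN p c).src.shift (mirror h hN p c).ν ∈ cubeSites (K := K) M c ∧
      ((mirror h hN p c).src.shift (mirror h hN p c).μ).shift (mirror h hN p c).ν ∈ cubeSites (K := K) M c := by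
  obtain ⟨h1, h2, h3, h4⟩ := cubeOf_mirror_corners h hN hp c
  exact ⟨mem_cubeSites.2 h1, mem_cubeSites.2 h2, mem_cubeSites.2 h3, mem_cubeSites.2 h4⟩

/-- **THE MIRROR FAMILY IS INJECTIVE** (the copy in cube `c` lies in cube `c`). [folklore] -/
theorem mirror_injective : Function.Injective (mirror h hN p) := by
  intro c c' hcc'
  have e := congrArg (fun q : Plaq P K => cubeOf M N q.src) hcc'
  simp only [mirror_src] at e
  rwa [(cubeOf_mirror_corners h hN hp c).1, (cubeOf_mirror_corners h hN hp c').1] at e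

/-- **THE COPY IN THE CUBE OF `p` IS `p`.** [folklore] -/
theorem mirror_cubeOf : mirror h hN p (cubeOf M N p.src) = p := by
  have e : mirrorSrc h hN p (cubeOf M N p.src) = p.src := by
    funext j
    apply ZMod.val_injective
    rw [val_mirrorSrc h hN hp, val_src_eq h]
    unfold offset
    rw [if_pos rfl]
  cases p
  simp only [mirror, Plaq.mk.injEq, and_true]
  exact e

/-- **COVARIANCE OF THE MIRROR FAMILY UNDER THE CUBE-CUT REFLECTIONS**: the cut reflection `(i, k)` carries the copy in
cube `c` to the copy in the reflected cube `cellReflect i k c` — the `sym` hypothesis of the chessboard for file 3.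
[folklore] -/
theorem cutPlaq_mirror (i : Fin P.d) (k : ZMod N) (c : BlockIdx P.d N) :
    cutPlaq K i (cubeCut h k) (mirror h hN p c) = mirror h hN p (cellReflect i k c) := by
  have hN1 : 1 < N := one_lt_of_even hN
  refine Plaq.ext' ?_ (by simp) (by simp)
  funext j
  by_cases hj : j = i
  · subst hj
    have hcj : cellReflect j k c j = 2 * k - 1 - c j := by
      rw [cellReflect_apply, Function.update_self]
    rw [cutPlaq_src_apply_same, mirror_src, mirror_src, mirror_μ, mirror_ν, mirrorSrc_apply, mirrorSrc_apply, hcj,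
      cubeCut_reflect h hN1]
    -- the parity flips, so the two branches of `offset` swap and the offsets add up to `M − 1 − extent`
    have hflip : (parity hN (2 * k - 1 - c j) = parity hN (cubeOf M N p.src j)) ↔
        ¬ (parity hN (c j) = parity hN (cubeOf M N p.src j)) := by
      rw [parity_reflect, one_add_eq_iff_ne]
    have hnat : offset M hN p c j + offset M hN p (cellReflect j k c) j + extent p j + 1 = M := by
      have hpj := hp j
      unfold offset
      rw [cellReflect_apply, Function.update_self]
      by_cases hpar : parity hN (c j) = parity hN (cubeOf M N p.src j)
      · rw [if_pos hpar, if_neg (fun h' => (hflip.1 h') hpar)]; omega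
      · rw [if_neg hpar, if_pos (hflip.2 hpar)]; omega
    have hext : ((extent p j : ℕ) : ZMod (P.sitesPerDir K)) = if p.μ = j ∨ p.ν = j then 1 else 0 := by
      unfold extent; split_ifs <;> simp
    have hsum : (offset M hN p c j : ZMod (P.sitesPerDir K)) +
        (offset M hN p (cellReflect j k c) j : ZMod (P.sitesPerDir K)) +
        (if p.μ = j ∨ p.ν = j then (1 : ZMod (P.sitesPerDir K)) else 0) + 1 = (M : ZMod (P.sitesPerDir K)) := by
      rw [← hext]
      exact_mod_cast congrArg (Nat.cast : ℕ → ZMod (P.sitesPerDir K)) hnat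
    linear_combination -hsum
  · rw [cutPlaq_src_apply_of_ne i _ _ hj, mirror_src, mirror_src, mirrorSrc_apply, mirrorSrc_apply]
    unfold offset
    rw [cellReflect_apply, Function.update_of_ne hj]

end Mirror

end

end Summit.QuantumFields.YangMills.Theorems.HistoryTailChessboardMirror
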